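import Summits.CriticalPhenomena.PercolationContinuityZ3.Theorems.PercNearOneGluingNoHeavyLowerTailGZSeriesLaw
import Summits.CriticalPhenomena.PercolationContinuityZ3.Theorems.PercNearOneGluingNoHeavyLowerTailGZSeriesHub
import HarnessLib

/-!
# `NoHeavyLowerTail` (stmt-CriticalPhenomena-4575) — support file: the SERIES STEP (THEOREM S) of the logarithmic covariance
# bound for actual weighted graphs (prover `prim-ineq-prove-2` gen 11; THEOREM-SP.md §5 with §2 (SER), §3)

No definitions, no named facts, no sorries.  Assembles `GZSeriesLaw.series_law_*` (the series composition law at measure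
level), `GZGluingLaw.network_facts` (cells of the two parts) and `GZSeriesHub.series_cov_sub_mul_log_le` (the cell-level
series step) into: if the sub-networks `E₁` (terminals `a, m`) and `E₂` (terminals `m, b`) both satisfy
`Cov(1{x↔c},1{y↔c}) ≤ P(xy|c)·log(P(x ↔ y off c)/P(xy|c))` for their terminal pairs and are non-degenerate, then the series
composite satisfies it for `(a, b)`.  With `GZGluingLaw.parallel_cov_le` this gives both composition steps of THEOREM SP.
-/

noncomputable section

namespace Summit.CriticalPhenomena.PercolationContinuityZ3.Theorems

open MeasureTheory Literature.Probability.LatticeModels Literature.Probability.Percolation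
open scoped Classical

namespace GZSeriesStep

variable {V : Type*} [Fintype V]

/-- The series step from the cell facts alone (pure real arithmetic around `GZSeriesHub.series_cov_sub_mul_log_le`).
[folklore] -/
theorem series_cov_le_of_facts
    {z₁ n₁ u₁ v₁ θ₁ a₁ b₁ z₂ n₂ u₂ v₂ θ₂ a₂ b₂ z n u v θ : ℝ}
    (f1u : u₁ = z₁ + a₁ - n₁) (f1v : v₁ = z₁ + b₁ - n₁) (f1xa : n₁ ≤ a₁) (f1xb : n₁ ≤ b₁)
    (f1t : z₁ - n₁ ≤ θ₁) (f1q : θ₁ + a₁ + b₁ - n₁ ≤ 1)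
    (f2u : u₂ = z₂ + a₂ - n₂) (f2v : v₂ = z₂ + b₂ - n₂) (f2xa : n₂ ≤ a₂) (f2xb : n₂ ≤ b₂)
    (f2t : z₂ - n₂ ≤ θ₂) (f2q : θ₂ + a₂ + b₂ - n₂ ≤ 1)
    (sθ : θ = θ₁ * θ₂) (su : u = a₁ + (z₁ - n₁) * u₂) (sv : v = b₂ + (z₂ - n₂) * v₁)
    (sz : z = a₁ * b₂ + n₁ * (z₂ - n₂) + (z₁ - n₁) * n₂ + (z₁ - n₁) * (z₂ - n₂)) (sn : n = z - (z₁ - n₁) * (z₂ - n₂))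
    (hn₁ : 0 ≤ n₁) (hn₂ : 0 ≤ n₂) (hw₁ : n₁ < z₁) (hw₂ : n₂ < z₂)
    (L₁ : z₁ - u₁ * v₁ ≤ (z₁ - n₁) * Real.log (θ₁ / (z₁ - n₁)))
    (L₂ : z₂ - u₂ * v₂ ≤ (z₂ - n₂) * Real.log (θ₂ / (z₂ - n₂))) :
    z - u * v ≤ (z - n) * Real.log (θ / (z - n)) := by
  have key := GZSeriesHub.series_cov_sub_mul_log_le
    (t₁ := θ₁ - (z₁ - n₁)) (w₁ := z₁ - n₁) (q₁ := 1 - θ₁ - a₁ - b₁ + n₁) (x₁ := a₁ - n₁) (y₁ := b₁ - n₁) (n₁ := n₁)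
    (t₂ := θ₂ - (z₂ - n₂)) (w₂ := z₂ - n₂) (q₂ := 1 - θ₂ - a₂ - b₂ + n₂) (x₂ := a₂ - n₂) (y₂ := b₂ - n₂) (n₂ := n₂)
    (by linarith) (by linarith) (by linarith) (by linarith) (by linarith) hn₁
    (by linarith) (by linarith) (by linarith) (by linarith) (by linarith) hn₂
    (by ring) (by ring)
  have hL₁ : (z₁ - n₁ + n₁) * (θ₁ - (z₁ - n₁) + (1 - θ₁ - a₁ - b₁ + n₁)) - (a₁ - n₁) * (b₁ - n₁) -
      (z₁ - n₁) * Real.log ((θ₁ - (z₁ - n₁) + (z₁ - n₁)) / (z₁ - n₁)) ≤ 0 := by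
    have e1 : (z₁ - n₁ + n₁) * (θ₁ - (z₁ - n₁) + (1 - θ₁ - a₁ - b₁ + n₁)) - (a₁ - n₁) * (b₁ - n₁) = z₁ - u₁ * v₁ := by
      rw [f1u, f1v]; ring
    have e2 : θ₁ - (z₁ - n₁) + (z₁ - n₁) = θ₁ := by ring
    rw [e1, e2]; linarith
  have hL₂ : (z₂ - n₂ + n₂) * (θ₂ - (z₂ - n₂) + (1 - θ₂ - a₂ - b₂ + n₂)) - (a₂ - n₂) * (b₂ - n₂) -
      (z₂ - n₂) * Real.log ((θ₂ - (z₂ - n₂) + (z₂ - n₂)) / (z₂ - n₂)) ≤ 0 := by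
    have e1 : (z₂ - n₂ + n₂) * (θ₂ - (z₂ - n₂) + (1 - θ₂ - a₂ - b₂ + n₂)) - (a₂ - n₂) * (b₂ - n₂) = z₂ - u₂ * v₂ := by
      rw [f2u, f2v]; ring
    have e2 : θ₂ - (z₂ - n₂) + (z₂ - n₂) = θ₂ := by ring
    rw [e1, e2]; linarith
  have hz1 : 0 ≤ z₁ - n₁ := by linarith
  have hz2 : 0 ≤ z₂ - n₂ := by linarith
  have m1 := mul_nonpos_of_nonneg_of_nonpos hz2 hL₁
  have m2 := mul_nonpos_of_nonneg_of_nonpos hz1 hL₂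
  have eθ : (θ₁ - (z₁ - n₁) + (z₁ - n₁)) * (θ₂ - (z₂ - n₂) + (z₂ - n₂)) = θ := by rw [sθ]; ring
  have ez : (n₁ + (a₁ - n₁)) * (n₂ + (b₂ - n₂)) + (z₁ - n₁) * n₂ + n₁ * (z₂ - n₂) + (z₁ - n₁) * (z₂ - n₂) = z := by
    rw [sz]; ring
  have eu : n₁ + (a₁ - n₁) + (z₁ - n₁) * (z₂ - n₂ + n₂ + (a₂ - n₂)) = u := by rw [su, f2u]; ring
  have ev : n₂ + (b₂ - n₂) + (z₂ - n₂) * (z₁ - n₁ + n₁ + (b₁ - n₁)) = v := by rw [sv, f1v]; ring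
  have ew : (z₁ - n₁) * (z₂ - n₂) = z - n := by rw [sn]; ring
  rw [eθ, ez, eu, ev, ew] at key
  linarith

/-- **Series step of THEOREM SP for weighted graphs** (THEOREM S, THEOREM-SP.md §5 with §2 (SER), §3).  Edge-disjoint
sub-networks `E₁` (terminals `a, m`) and `E₂` (terminals `m, b`) on vertex sets meeting inside `{m, c}`, `a ∉ V₂`, `b ∉ V₁`,
each non-degenerate (`P(xy|c) > 0`) and each satisfying the logarithmic covariance bound for ITS terminal pair (events read
on `ω ∩ Eᵢ`); then the composite satisfies it for the pair `(a, b)`. -/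
theorem series_cov_le (w : Sym2 V → unitInterval) {E₁ E₂ : Finset (Sym2 V)} {V₁ V₂ : Set V} {a b m c : V}
    (h₁ : ∀ e ∈ (↑E₁ : Set (Sym2 V)), ∀ z ∈ e, z ∈ V₁) (h₂ : ∀ e ∈ (↑E₂ : Set (Sym2 V)), ∀ z ∈ e, z ∈ V₂)
    (hS : V₁ ∩ V₂ ⊆ {m, c}) (haV₂ : a ∉ V₂) (hbV₁ : b ∉ V₁)
    (ham : a ≠ m) (hac : a ≠ c) (hab : a ≠ b) (hbm : b ≠ m) (hbc : b ≠ c) (hmc : m ≠ c) (hdisj : Disjoint E₁ E₂)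
    (hw₁ : (prodBernoulli w).real ({ω : Set (Sym2 V) | ¬(openGraph (ω ∩ (↑E₁ : Set (Sym2 V)))).Reachable a m} ∩ {ω : Set (Sym2 V) | ¬(openGraph (ω ∩ (↑E₁ : Set (Sym2 V)))).Reachable a c} ∩ {ω : Set (Sym2 V) | ¬(openGraph (ω ∩ (↑E₁ : Set (Sym2 V)))).Reachable m c}) <
      (prodBernoulli w).real ({ω : Set (Sym2 V) | ¬(openGraph (ω ∩ (↑E₁ : Set (Sym2 V)))).Reachable a c} ∩ {ω : Set (Sym2 V) | ¬(openGraph (ω ∩ (↑E₁ : Set (Sym2 V)))).Reachable m c}))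
    (hw₂ : (prodBernoulli w).real ({ω : Set (Sym2 V) | ¬(openGraph (ω ∩ (↑E₂ : Set (Sym2 V)))).Reachable m b} ∩ {ω : Set (Sym2 V) | ¬(openGraph (ω ∩ (↑E₂ : Set (Sym2 V)))).Reachable m c} ∩ {ω : Set (Sym2 V) | ¬(openGraph (ω ∩ (↑E₂ : Set (Sym2 V)))).Reachable b c}) <
      (prodBernoulli w).real ({ω : Set (Sym2 V) | ¬(openGraph (ω ∩ (↑E₂ : Set (Sym2 V)))).Reachable m c} ∩ {ω : Set (Sym2 V) | ¬(openGraph (ω ∩ (↑E₂ : Set (Sym2 V)))).Reachable b c}))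
    (L₁ : (prodBernoulli w).real ({ω : Set (Sym2 V) | ¬(openGraph (ω ∩ (↑E₁ : Set (Sym2 V)))).Reachable a c} ∩ {ω : Set (Sym2 V) | ¬(openGraph (ω ∩ (↑E₁ : Set (Sym2 V)))).Reachable m c}) -
        (prodBernoulli w).real {ω : Set (Sym2 V) | ¬(openGraph (ω ∩ (↑E₁ : Set (Sym2 V)))).Reachable a c} *
          (prodBernoulli w).real {ω : Set (Sym2 V) | ¬(openGraph (ω ∩ (↑E₁ : Set (Sym2 V)))).Reachable m c} ≤
      ((prodBernoulli w).real ({ω : Set (Sym2 V) | ¬(openGraph (ω ∩ (↑E₁ : Set (Sym2 V)))).Reachable a c} ∩ {ω : Set (Sym2 V) | ¬(openGraph (ω ∩ (↑E₁ : Set (Sym2 V)))).Reachable m c}) -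
          (prodBernoulli w).real ({ω : Set (Sym2 V) | ¬(openGraph (ω ∩ (↑E₁ : Set (Sym2 V)))).Reachable a m} ∩ {ω : Set (Sym2 V) | ¬(openGraph (ω ∩ (↑E₁ : Set (Sym2 V)))).Reachable a c} ∩ {ω : Set (Sym2 V) | ¬(openGraph (ω ∩ (↑E₁ : Set (Sym2 V)))).Reachable m c})) *
        Real.log ((prodBernoulli w).real {ω : Set (Sym2 V) | (openGraph ((ω ∩ (↑E₁ : Set (Sym2 V))) \ {e : Sym2 V | c ∈ e})).Reachable a m} /
          ((prodBernoulli w).real ({ω : Set (Sym2 V) | ¬(openGraph (ω ∩ (↑E₁ : Set (Sym2 V)))).Reachable a c} ∩ {ω : Set (Sym2 V) | ¬(openGraph (ω ∩ (↑E₁ : Set (Sym2 V)))).Reachable m c}) -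
            (prodBernoulli w).real ({ω : Set (Sym2 V) | ¬(openGraph (ω ∩ (↑E₁ : Set (Sym2 V)))).Reachable a m} ∩ {ω : Set (Sym2 V) | ¬(openGraph (ω ∩ (↑E₁ : Set (Sym2 V)))).Reachable a c} ∩ {ω : Set (Sym2 V) | ¬(openGraph (ω ∩ (↑E₁ : Set (Sym2 V)))).Reachable m c}))))
    (L₂ : (prodBernoulli w).real ({ω : Set (Sym2 V) | ¬(openGraph (ω ∩ (↑E₂ : Set (Sym2 V)))).Reachable m c} ∩ {ω : Set (Sym2 V) | ¬(openGraph (ω ∩ (↑E₂ : Set (Sym2 V)))).Reachable b c}) -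
        (prodBernoulli w).real {ω : Set (Sym2 V) | ¬(openGraph (ω ∩ (↑E₂ : Set (Sym2 V)))).Reachable m c} *
          (prodBernoulli w).real {ω : Set (Sym2 V) | ¬(openGraph (ω ∩ (↑E₂ : Set (Sym2 V)))).Reachable b c} ≤
      ((prodBernoulli w).real ({ω : Set (Sym2 V) | ¬(openGraph (ω ∩ (↑E₂ : Set (Sym2 V)))).Reachable m c} ∩ {ω : Set (Sym2 V) | ¬(openGraph (ω ∩ (↑E₂ : Set (Sym2 V)))).Reachable b c}) -
          (prodBernoulli w).real ({ω : Set (Sym2 V) | ¬(openGraph (ω ∩ (↑E₂ : Set (Sym2 V)))).Reachable m b} ∩ {ω : Set (Sym2 V) | ¬(openGraph (ω ∩ (↑E₂ : Set (Sym2 V)))).Reachable m c} ∩ {ω : Set (Sym2 V) | ¬(openGraph (ω ∩ (↑E₂ : Set (Sym2 V)))).Reachable b c})) *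
        Real.log ((prodBernoulli w).real {ω : Set (Sym2 V) | (openGraph ((ω ∩ (↑E₂ : Set (Sym2 V))) \ {e : Sym2 V | c ∈ e})).Reachable m b} /
          ((prodBernoulli w).real ({ω : Set (Sym2 V) | ¬(openGraph (ω ∩ (↑E₂ : Set (Sym2 V)))).Reachable m c} ∩ {ω : Set (Sym2 V) | ¬(openGraph (ω ∩ (↑E₂ : Set (Sym2 V)))).Reachable b c}) -
            (prodBernoulli w).real ({ω : Set (Sym2 V) | ¬(openGraph (ω ∩ (↑E₂ : Set (Sym2 V)))).Reachable m b} ∩ {ω : Set (Sym2 V) | ¬(openGraph (ω ∩ (↑E₂ : Set (Sym2 V)))).Reachable m c} ∩ {ω : Set (Sym2 V) | ¬(openGraph (ω ∩ (↑E₂ : Set (Sym2 V)))).Reachable b c})))) :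
    (prodBernoulli w).real ({ω : Set (Sym2 V) | ¬(openGraph (ω ∩ ((↑E₁ : Set (Sym2 V)) ∪ ↑E₂))).Reachable a c} ∩ {ω : Set (Sym2 V) | ¬(openGraph (ω ∩ ((↑E₁ : Set (Sym2 V)) ∪ ↑E₂))).Reachable b c}) -
        (prodBernoulli w).real {ω : Set (Sym2 V) | ¬(openGraph (ω ∩ ((↑E₁ : Set (Sym2 V)) ∪ ↑E₂))).Reachable a c} *
          (prodBernoulli w).real {ω : Set (Sym2 V) | ¬(openGraph (ω ∩ ((↑E₁ : Set (Sym2 V)) ∪ ↑E₂))).Reachable b c} ≤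
      ((prodBernoulli w).real ({ω : Set (Sym2 V) | ¬(openGraph (ω ∩ ((↑E₁ : Set (Sym2 V)) ∪ ↑E₂))).Reachable a c} ∩ {ω : Set (Sym2 V) | ¬(openGraph (ω ∩ ((↑E₁ : Set (Sym2 V)) ∪ ↑E₂))).Reachable b c}) -
          (prodBernoulli w).real ({ω : Set (Sym2 V) | ¬(openGraph (ω ∩ ((↑E₁ : Set (Sym2 V)) ∪ ↑E₂))).Reachable a b} ∩ {ω : Set (Sym2 V) | ¬(openGraph (ω ∩ ((↑E₁ : Set (Sym2 V)) ∪ ↑E₂))).Reachable a c} ∩ {ω : Set (Sym2 V) | ¬(openGraph (ω ∩ ((↑E₁ : Set (Sym2 V)) ∪ ↑E₂))).Reachable b c})) *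
        Real.log ((prodBernoulli w).real {ω : Set (Sym2 V) | (openGraph ((ω ∩ ((↑E₁ : Set (Sym2 V)) ∪ ↑E₂)) \ {e : Sym2 V | c ∈ e})).Reachable a b} /
          ((prodBernoulli w).real ({ω : Set (Sym2 V) | ¬(openGraph (ω ∩ ((↑E₁ : Set (Sym2 V)) ∪ ↑E₂))).Reachable a c} ∩ {ω : Set (Sym2 V) | ¬(openGraph (ω ∩ ((↑E₁ : Set (Sym2 V)) ∪ ↑E₂))).Reachable b c}) -
            (prodBernoulli w).real ({ω : Set (Sym2 V) | ¬(openGraph (ω ∩ ((↑E₁ : Set (Sym2 V)) ∪ ↑E₂))).Reachable a b} ∩ {ω : Set (Sym2 V) | ¬(openGraph (ω ∩ ((↑E₁ : Set (Sym2 V)) ∪ ↑E₂))).Reachable a c} ∩ {ω : Set (Sym2 V) | ¬(openGraph (ω ∩ ((↑E₁ : Set (Sym2 V)) ∪ ↑E₂))).Reachable b c}))) := by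
  obtain ⟨f1u, f1v, f1xa, f1xb, -, f1t, f1q, -, -⟩ := GZGluingLaw.network_facts w (↑E₁ : Set (Sym2 V)) (b := m) hac rfl rfl rfl rfl
  obtain ⟨f2u, f2v, f2xa, f2xb, -, f2t, f2q, -, -⟩ :=
    GZGluingLaw.network_facts w (↑E₂ : Set (Sym2 V)) (a := m) (b := b) hmc rfl rfl rfl rfl
  have sθ := GZSeriesLaw.series_law_theta w h₁ h₂ hS haV₂ hbV₁ ham hac hab hbm hbc hmc hdisj
  have su := GZSeriesLaw.series_law_u w h₁ h₂ hS haV₂ hbV₁ ham hac hab hbm hbc hmc hdisj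
  have sv := GZSeriesLaw.series_law_v w h₁ h₂ hS haV₂ hbV₁ ham hac hab hbm hbc hmc hdisj
  have sz := GZSeriesLaw.series_law_z w h₁ h₂ hS haV₂ hbV₁ ham hac hab hbm hbc hmc hdisj
  have sn := GZSeriesLaw.series_law_n w h₁ h₂ hS haV₂ hbV₁ ham hac hab hbm hbc hmc hdisj
  have hw₁' : (prodBernoulli w).real {ω : Set (Sym2 V) | ¬(openGraph (ω ∩ (↑E₁ : Set (Sym2 V)))).Reachable a c} -
      (prodBernoulli w).real ({ω : Set (Sym2 V) | ¬(openGraph (ω ∩ (↑E₁ : Set (Sym2 V)))).Reachable a m} ∩ {ω : Set (Sym2 V) | ¬(openGraph (ω ∩ (↑E₁ : Set (Sym2 V)))).Reachable a c}) =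
      (prodBernoulli w).real ({ω : Set (Sym2 V) | ¬(openGraph (ω ∩ (↑E₁ : Set (Sym2 V)))).Reachable a c} ∩ {ω : Set (Sym2 V) | ¬(openGraph (ω ∩ (↑E₁ : Set (Sym2 V)))).Reachable m c}) -
        (prodBernoulli w).real ({ω : Set (Sym2 V) | ¬(openGraph (ω ∩ (↑E₁ : Set (Sym2 V)))).Reachable a m} ∩ {ω : Set (Sym2 V) | ¬(openGraph (ω ∩ (↑E₁ : Set (Sym2 V)))).Reachable a c} ∩ {ω : Set (Sym2 V) | ¬(openGraph (ω ∩ (↑E₁ : Set (Sym2 V)))).Reachable m c}) := by linarith [f1u]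
  have hw₂' : (prodBernoulli w).real {ω : Set (Sym2 V) | ¬(openGraph (ω ∩ (↑E₂ : Set (Sym2 V)))).Reachable b c} -
      (prodBernoulli w).real ({ω : Set (Sym2 V) | ¬(openGraph (ω ∩ (↑E₂ : Set (Sym2 V)))).Reachable m b} ∩ {ω : Set (Sym2 V) | ¬(openGraph (ω ∩ (↑E₂ : Set (Sym2 V)))).Reachable b c}) =
      (prodBernoulli w).real ({ω : Set (Sym2 V) | ¬(openGraph (ω ∩ (↑E₂ : Set (Sym2 V)))).Reachable m c} ∩ {ω : Set (Sym2 V) | ¬(openGraph (ω ∩ (↑E₂ : Set (Sym2 V)))).Reachable b c}) -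
        (prodBernoulli w).real ({ω : Set (Sym2 V) | ¬(openGraph (ω ∩ (↑E₂ : Set (Sym2 V)))).Reachable m b} ∩ {ω : Set (Sym2 V) | ¬(openGraph (ω ∩ (↑E₂ : Set (Sym2 V)))).Reachable m c} ∩ {ω : Set (Sym2 V) | ¬(openGraph (ω ∩ (↑E₂ : Set (Sym2 V)))).Reachable b c}) := by linarith [f2v]
  rw [hw₁'] at su sz
  rw [hw₂'] at sv sz
  exact series_cov_le_of_facts f1u f1v f1xa f1xb f1t f1q f2u f2v f2xa f2xb f2t f2q sθ su sv sz sn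
    measureReal_nonneg measureReal_nonneg hw₁ hw₂ L₁ L₂

end GZSeriesStep

end Summit.CriticalPhenomena.PercolationContinuityZ3.Theorems
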